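import Literature.NumberTheory.EllipticCurves.CastellaGrossiLeeSkinner2022.HowardDivisibilityAnyClassNumber
import Literature.NumberTheory.EllipticCurves.HeegnerNormPointExistenceProofs
import HarnessLib

/-!
# Castella–Grossi–Lee–Skinner 2022, Thm. 4.1.1 / Rem. 4.1.4: the `d(k)`-shifted stabilised Heegner datum
# EXISTS from the tower containment `K_k ⊆ K[p^d]` — route-free proofs file

Topic `NumberTheory/EllipticCurves`. THEOREMS ONLY (no definition, no named fact, no `sorry`), on the
vocabulary of `CastellaGrossiLeeSkinner2022/HowardDivisibilityAnyClassNumber.lean` (`StabilizedHeegnerData`)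
and `HeegnerModuleIndex.lean` / `HeegnerNormPointExistenceProofs.lean` (`ringClassSubgroup`,
`IsHeegnerNormPoint`, `exists_isHeegnerNormPoint_holds`, `finiteIndex_ringClassSubgroup`).
ROUTE-FREE HOME of the constructor first landed by seat x9-p2 inside the route-coned Theorems file
`Summits/…/Theorems/PrintX9HowardContainmentLightFrameOfPrintDepthPosLocalized.lean` (p607064,
`Summit.BirchSwinnertonDyer.Rank1Residual.X9.exists_stabilizedHeegnerData_of_tower`, which imports
`Theses.PrintX9`): the statement and proof below are that theorem VERBATIM (credit: prover-bsd-line-x9-p2-0),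
re-homed so that row-9 AND row-10 consumers (PrintX9 / TorsionLayerDescent / PrintX10b helper files) can
import it without entering a route cone (gate lint `lint.theses-cone`). Re-homed by seat x10b-p2 (lead of
line `torsion-depth-x10b`, crux stmt-BirchSwinnertonDyer-23729). HONEST FRAMING: bookkeeping over the tree's
definitions (the tower containment is a HYPOTHESIS — classical CFT, `K_∞^{ac} ⊂ K[p^∞]`, not a tree theorem);
nothing about `L`-functions or Selmer groups; BSD is not proved by any of this.

* `StabilizedHeegnerData.le_index_of_ringClassSubgroup_one_le` — `K_k ⊆ K[1] ⟹ k ≤ [Γ_K : Gal(K̄/K[1])]`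
  (the torsion layers are bounded: `p^k ∣` a finite positive index).
* `StabilizedHeegnerData.exists_of_tower` — for `W/ℚ` elliptic, `Dt` a parametrisation datum at a level `N`
  prime to `p`, `K` imaginary quadratic Heegner for `N`, an orientation `β`, an embedding `jbar` and a
  `ℤ_p`-extension `κ` whose every layer lies in some `K[p^d]`: a term `C : StabilizedHeegnerData N W K κ jbar`
  with `C.Dt = Dt`, `C.β = β` and `0 < C.depth ↔ K_1 ⊆ K[1]` (shift `d(k) = min{d : K_k ⊆ K[p^d]}` by
  `Nat.find`, depth `δ = max{k : K_k ⊆ K[1]}` by `Nat.findGreatest`, norm points `u_k`, `v_k` by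
  `exists_isHeegnerNormPoint_holds`).

References: [CastellaGrossiLeeSkinner2022] Thm. 4.1.1 proof (`d(k)`, `P_k[n]`) and Rem. 4.1.4
(arXiv:2008.02571 p. 22); [PerrinRiou1987BSMF] §1, §3.1; [Howard2004HeegnerKolyvagin] §2.7, §3.3;
[Cox2013] Thm. 11.1.
-/

set_option autoImplicit false

noncomputable section

open scoped Classical

namespace Literature.NumberTheory.EllipticCurves.CastellaGrossiLeeSkinner2022

open WeierstrassCurve ModularForms

namespace StabilizedHeegnerData

variable {N : ℕ} [NeZero N] {W : WeierstrassCurve ℚ} [W.IsElliptic] {K : Type} [Field K]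
  [NumberField K] {p : ℕ} [Fact p.Prime] {κ : ZpExtension K p} {jbar : AlgebraicClosure K →+* ℂ}

/-- **Boundedness of the torsion layers**: if `K_k ⊆ K[1]` (`Gal(K̄/K[1]) ≤ Gal(K̄/K_k)`) then
`p^k = [Γ_K : Gal(K̄/K_k)]` divides the (finite, positive) index of `Gal(K̄/K[1])`, so
`k ≤ [Γ_K : Gal(K̄/K[1])]`. (Verbatim x9-p2's `X9.le_index_of_ringClassSubgroup_one_le`, p607064.)
[cite: CastellaGrossiLeeSkinner2022, Thm. 4.1.1 proof (d(k) = 0 for finitely many k, arXiv:2008.02571 p. 22)]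
[cite: Cox2013, Thm. 11.1 (K[1] = K(j(𝒪_K)) is finite over K)] -/
theorem le_index_of_ringClassSubgroup_one_le {k : ℕ}
    (hk : ringClassSubgroup K 1 jbar ≤ κ.layerSubgroup k) :
    k ≤ (ringClassSubgroup K 1 jbar).index := by
  haveI := finiteIndex_ringClassSubgroup (K := K) 1 jbar
  have hdvd : (κ.layerSubgroup k).index ∣ (ringClassSubgroup K 1 jbar).index :=
    Subgroup.index_dvd_of_le hk
  rw [ZpExtension.index_layerSubgroup] at hdvd
  have hpos : 0 < (ringClassSubgroup K 1 jbar).index :=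
    Nat.pos_of_ne_zero Subgroup.FiniteIndex.index_ne_zero
  have hle : p ^ k ≤ (ringClassSubgroup K 1 jbar).index := Nat.le_of_dvd hpos hdvd
  exact le_trans (Nat.lt_pow_self (Fact.out : p.Prime).one_lt).le hle

/-- **CGLS 2022 Thm. 4.1.1 / Rem. 4.1.4 — the `d(k)`-shifted, `α`-stabilised Heegner datum EXISTS at
`(K, κ, jbar)` as soon as every layer `K_k` lies in some ring class field `K[p^d]`** (`K_∞^{ac} ⊂ K[p^∞]`,
Perrin-Riou 1987 §1), for `W/ℚ` elliptic with a parametrisation datum `Dt` at a level `N` prime to `p`, `K`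
imaginary quadratic Heegner for `N` and an orientation `β` — WITH the given `Dt`, `β` (the pin of the cell's
PIN-1 ruling), and with torsion depth `δ > 0` iff `K_1 ⊆ K[1]`. Construction: `d(k) = min {d : K_k ⊆ K[p^d]}`
(`Nat.find`: `layer_le`, `d_min`); `δ = max {k : K_k ⊆ K[1]}` (`Nat.findGreatest`; a bounded down-set
containing `0`), whence `d(k) = 0 ↔ k ≤ δ`; `u_k`, `v_k` of conductors `p^{d(k)}`, `p^{d(k)-1}` (prime to `N`)
at every layer by `exists_isHeegnerNormPoint_holds`. (Verbatim x9-p2's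
`X9.exists_stabilizedHeegnerData_of_tower`, p607064, re-homed route-free.)
[cite: CastellaGrossiLeeSkinner2022, Thm. 4.1.1 proof (d(k), P_k[n]) and Rem. 4.1.4 (arXiv:2008.02571 p. 22)]
[cite: PerrinRiou1987BSMF, §1 and §3.1] [cite: Howard2004HeegnerKolyvagin, §2.7 and §3.3] -/
theorem exists_of_tower (hK : IsImaginaryQuadratic K)
    (hH : SatisfiesHeegnerHypothesis N K) (hpN : ¬ p ∣ N) (Dt : ModularParametrizationData W N)
    {β : ℤ} (hβ : (4 * N : ℤ) ∣ β ^ 2 - NumberField.discr K)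
    (hTw : ∀ k : ℕ, ∃ d : ℕ, ringClassSubgroup K (p ^ d) jbar ≤ κ.layerSubgroup k) :
    ∃ C : StabilizedHeegnerData N W K κ jbar, C.Dt = Dt ∧ C.β = β ∧
      (0 < C.depth ↔ ringClassSubgroup K 1 jbar ≤ κ.layerSubgroup 1) := by
  have hc : ∀ e : ℕ, (p ^ e).Coprime N := fun e ↦
    Nat.Coprime.pow_left _ ((Fact.out : p.Prime).coprime_iff_not_dvd.mpr hpN)
  have hex : ∀ (n e : ℕ), ∃ z, IsHeegnerNormPoint N W K κ Dt β jbar n (p ^ e) z := fun n e ↦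
    exists_isHeegnerNormPoint_holds N W K p hK hH κ Dt hβ jbar n (hc e)
  choose u hu using fun k ↦ hex k (Nat.find (hTw k))
  choose v hv using fun k ↦ hex k (Nat.find (hTw k) - 1)
  -- the torsion depth: the largest `k ≤ [Γ_K : Gal(K̄/K[1])]` with `K_k ⊆ K[1]`
  let P : ℕ → Prop := fun k ↦ ringClassSubgroup K 1 jbar ≤ κ.layerSubgroup k
  have hP0 : P 0 := by
    show ringClassSubgroup K 1 jbar ≤ κ.layerSubgroup 0
    rw [ZpExtension.layerSubgroup_zero]; exact le_top
  have hδ : P (Nat.findGreatest P (ringClassSubgroup K 1 jbar).index) :=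
    Nat.findGreatest_spec (P := P) (Nat.zero_le _) hP0
  have hiff : ∀ k, P k ↔ k ≤ Nat.findGreatest P (ringClassSubgroup K 1 jbar).index := fun k ↦
    ⟨fun hk ↦ Nat.le_findGreatest (le_index_of_ringClassSubgroup_one_le hk) hk,
      fun hk ↦ le_trans hδ (κ.layerSubgroup_antitone hk)⟩
  refine ⟨{ Dt := Dt
            β := β
            dvd_sq_sub := hβ
            d := fun k ↦ Nat.find (hTw k)
            layer_le := fun k ↦ Nat.find_spec (hTw k)
            d_min := fun k _ hd' ↦ Nat.find_min (hTw k) hd'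
            depth := Nat.findGreatest P (ringClassSubgroup K 1 jbar).index
            d_eq_zero_iff := fun k ↦ by rw [Nat.find_eq_zero, pow_zero]; exact hiff k
            u := u
            isHeegnerNormPoint_u := fun k _ ↦ hu k
            v := v
            isHeegnerNormPoint_v := fun k _ ↦ hv k }, rfl, rfl, ?_⟩
  show 0 < Nat.findGreatest P (ringClassSubgroup K 1 jbar).index ↔ P 1
  rw [hiff 1]
  omega

end StabilizedHeegnerData

end Literature.NumberTheory.EllipticCurves.CastellaGrossiLeeSkinner2022

end
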